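import Literature.MathematicalPhysics.QuantumFieldTheory.Balaban1983to89.B9Eq375GradDivSplitY
import Literature.MathematicalPhysics.QuantumFieldTheory.Balaban1983to89.B9Ineq373HessianPieceBoundsY

/-!
# `Balaban1983to89.B9Ineq375GradDivBoundsY` — [B9] (3.73) p. 405 FOR THE GRADIENT–DIVERGENCE WORD `V₂(A) = D₁D*₁ − D_VD*_V` OF (3.75) AT def-Y'S LETTERS: the
# pointwise stencil bounds of part I's letters `P0Y`, `P1Y ν` from the bond window `‖V − 1‖ ≤ ω₁` and the variation window `‖V(y) − V(y − e_μ)‖ ≤ ω₂`, and ★★★ the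
# REALIFIED (3.73)-majorants `conj b(P¹_ν) ≺ (M₂Σ‖b_j‖)·c_{P1}(d)·e^{2δ}·α₁·len(a)⁻¹·e^{−δd}`, `conj b(P⁰) ≺ (M₂Σ‖b_j‖)·c_{P0}(d)·e^{2δ}·α₁·(len(a)²)⁻¹·e^{−δd}` over
# `toB6 (geoCK i □) Rr H` — the first-order half of the projection piece in the shape of `cor35_G_cube_of_pieces`' `hV0`∕`hV1 ν` (sub-row G-B9-LETTERS, module M5.1b-G,
# FILE G-F5b part II)

T. Bałaban, *Propagators for lattice gauge theories in a background field*, Commun. Math. Phys. **99** (1985) 389–434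
[`Balaban1985BackgroundPropagators`, "B9"]; [4] = Commun. Math. Phys. **96** (1984) 223–250 [`Balaban1984PropagatorsII`].

statement-level skeleton of published theorems with citation tags; proofs where landed; nothing here is a claim about the
Yang–Mills mass gap

THE PRINTED LOCUS (verbatim, held `paper:balaban1985-cmp99-background-propagators` p0017 = p. 405; page owner r06).  *«(D_{U′U}D\*_{U′U}A′)_μ(x) = (D_UD\*_UA′)_μ(x) − Σ_ν[…]
− (F_{2,k}(A)A′)_μ(x) = (DD\*A′)_μ(x) − (V₂(A)A′)_μ(x), (3.75) where the operators F_{2,k}(A), V₂(A) satisfy the bounds (3.72), (3.73).»*; (3.73) p. 405: *«|(V₁(A)A′)(b)| ≦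
O(1)(|∇A||A′| + |A|²|A′|) + O(1)|A|(|∇_UA′| + …) ≦ O(1)α₁((Lʲη)⁻¹|∇_UA′| + (Lʲη)⁻²|A′|), b ∈ Ω_j … with the same conditions on norms as above [«determined by the set st(b)»].
The constant O(1) is an absolute constant depending on d only.»*; (3.37) p. 396: *«|A′| < α₁(Lʲη)⁻¹, |∇^η_UA′| < α₁(Lʲη)⁻² on Ω_j»*.

WHY THIS FILE (cell `lit-balaban`, sub-row G-B9-LETTERS; module M5.1b-G = Cor. 3.5∕3.6 for the BOND-sector cube letter `G_□ = Δ_{a,□}⁻¹`).  Part I (`B9Eq375GradDivSplitY`,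
p652820) proved `D₁D*₁ − D_VD*_V = P0Y V + Σ_ν P1Y V ν ∘ₗ nablaY ν` with explicit finite stencils: `P1Y ν` carries one factor `c_f(R(V) − 1)` (resp. `c_f(R(V)⁻¹ − 1)`),
`P0Y` carries `c_f²·(R(V_μ(y+e_κ))⁻¹ − R(V_μ(y))⁻¹)` (a VARIATION) or a product of two `c_f(R(V)^{±1} − 1)`.  THIS FILE is the twin of G-F5a III (`B9Ineq373HessianPieceBoundsY`,
p649571) for these letters: under the bond window `‖V_a(y) − 1‖ ≤ ω₁` and the variation window `‖V_a(y) − V_a(y−e_μ)‖ ≤ ω₂` in the distance-2 block neighbourhood of the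
output bond (bi-contractive `V`), `‖(P¹_νY)(b)‖ ≤ |c_f|·2(d+2)·ω₁·sup|Y|` and `‖(P⁰X)(b)‖ ≤ c_f²·(d+1)·(2ω₂ + 4ω₁²)·sup|X|` (sups over the stencil); with `ω₁ = α₁η∕len(a)`,
`ω₂ = α₁(η∕len(a))²`, `|c_f| = η⁻¹`, `α₁ ≤ 1` these are print's `O(1)α₁(Lⁿη)⁻¹` and `O(1)α₁(Lⁿη)⁻²`, and n06-c's reading⇒majorant device
(`B9SectBGpReadingsY.hasMajorant_conj_of_liftY_bound`) realifies them over r05's cube blocks.  With part I's `conj_gradDiv_one_sub_gradDiv_eq` this delivers the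
gradient–divergence half of `projPieceK` in the `V⁰ + Σ_ν V¹_ν·DK ν` currency; the windows themselves come from `B9Cor36GCubeWindows` (p651989, bridge II) at `Ṽ_□`.

WHAT THIS FILE PROVES (THEOREMS + the real constants `cP1 d = 2(d+2)`, `cP0 d = 6(d+1)`; 0 `def … : Prop`, 0 sorry).
* §1 `norm_Rinv_sub_Rinv_le` (`‖R(u⁻¹)w − R(u′⁻¹)w‖ ≤ 2‖u − u′‖‖w‖`, bi-contractive), the letter bounds at a bond: `norm_P1aY_apply_le`, `norm_P1bY_apply_le`, `norm_P0aY_apply_le`,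
  `norm_EdY_apply_le`, `norm_EgY_EdY_apply_le`.
* §2 ★ `norm_P1Y_apply_le` (`≤ |c_f|·2(d+2)ω₁·s`), ★ `norm_P0Y_apply_le` (`≤ c_f²(d+1)(2ω₂ + 4ω₁²)·s`) in the `dSite ≤ 2` block-neighbourhood form of G-F5a III.
* §3 `cP1`, `cP0`, ★★★ `hasMajorant_P1Y`, ★★★ `hasMajorant_P0Y` (realified, over `toB6 (geoCK i □) Rr H`, block map `blkBK i □`).

HONEST SCOPE.  Finite stencil algebra + n06-c's realification device over landed modules; nothing of [B9]'s analysis is asserted.  DISPLAYED (hypotheses): the two windows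
in block-neighbourhood form, bi-contractivity of `V`, the basis constant `M₂`, and `α₁ ≤ 1` for `P⁰`.  The non-local `P₁(A)` ((3.76)–(3.77)) and the generalised assembly are
NOT here.  Count-neutral; NOT a node discharge; no summit ∕ sub-problem statement is proved; nothing continuum ∕ OS ∕ mass-gap ∕ Clay; YM mass gap NOT proved by any of this
(Track A conditional rung).  No `sorry`, no `axiom`, no `… : Prop` fact, no `instance`, no `notation`.  NEW file; nothing landed is modified.  Cell `lit-balaban`, seat
`lit-balaban-p38` gen 43, 2026-08-28; `--supports stmt-QuantumFields-19200`.  Net new unproved facts: 0.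

RELATED IN THE TREE, NOT DUPLICATED: G-F5a III `B9Ineq373HessianPieceBoundsY` (the Hessian twin; `norm_R_sub_R_le`, `norm_Rinv_sub_self_le`, `dSite*` USED), part I (letters), r06's
`B9Eq376POneLetters.norm_gradLin_sub_apply_le`∕`norm_divLin_sub_apply_le` (sizes of `E`, `E*` on generic carriers), bridge II `B9Cor36GCubeWindows` (the windows at `Ṽ_□`).
-/

noncomputable section

namespace Literature.MathematicalPhysics.QuantumFieldTheory.Balaban1983to89.B9Ineq375GradDivBoundsY

open Node00
open Literature.MathematicalPhysics.QuantumFieldTheory.Balaban1983to89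
open Literature.MathematicalPhysics.QuantumFieldTheory.Balaban1983to89.B6RandomWalk (HasMajorant)
open Literature.MathematicalPhysics.QuantumFieldTheory.Balaban1983to89.B9Thm34Ext (toB6)
open Literature.MathematicalPhysics.QuantumFieldTheory.Balaban1983to89.B6KLevelCensusIndexV1 (KIdx kGeo)
open Literature.MathematicalPhysics.QuantumFieldTheory.Balaban1983to89.B6GlobalChartV1 (PV)
open Literature.MathematicalPhysics.QuantumFieldTheory.Balaban1983to89.B6Cover236MultiLevelBlocks (cubes)
open Literature.MathematicalPhysics.QuantumFieldTheory.Balaban1983to89.B9Eq39Adjoint (R R_sub R_smul)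
open Literature.MathematicalPhysics.QuantumFieldTheory.Balaban1983to89.B9CubeLettersOpsL0 (cubeFamY)
open Literature.MathematicalPhysics.QuantumFieldTheory.Balaban1983to89.B9CubeLettersBondOpsL0 (BlkCubeY)
open Literature.MathematicalPhysics.QuantumFieldTheory.Balaban1983to89.B9Eq360DeltaPrimeACubeY (blkCubeY)
open Literature.MathematicalPhysics.QuantumFieldTheory.Balaban1983to89.B6GlobalChartV1L0 (blkV1)
open Literature.MathematicalPhysics.QuantumFieldTheory.Balaban1983to89.B9CubeGeometryInputs (geoCK geoCK_len geoCK_len_pos geoCK_eta geoCK_eta_pos)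
open Literature.MathematicalPhysics.QuantumFieldTheory.Balaban1983to89.B9Eq371HessianSplitY (nablaY nablaY_apply)
open Literature.MathematicalPhysics.QuantumFieldTheory.Balaban1983to89.B9Eq371CoCurlLeibnizY (unshift_shift_comm)
open Literature.MathematicalPhysics.QuantumFieldTheory.Balaban1983to89.B9Eq375GradDivSplitY (EgY EdY EgY_apply_mk EdY_apply_chartY P1aY P1aY_apply_mk P0aY P0aY_apply_mk
  P1bY P1bY_apply_mk P0Y P1Y)
open Literature.MathematicalPhysics.QuantumFieldTheory.Balaban1983to89.B9Ineq373HessianPieceBoundsY (norm_R_sub_R_le norm_Rinv_sub_self_le dSite dSite_shift_le dSite_self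
  blkV1_cubeFamY_eq abs_cf_eq)
open Literature.MathematicalPhysics.QuantumFieldTheory.Balaban1983to89.B9Cor35GCubeInputsAtOne (blkBK)
open Literature.MathematicalPhysics.QuantumFieldTheory.Balaban1983to89.Node00.OpsYNablaBridge (chartY shift_unshift unshift_shift)

variable {d ℓ : ℕ} {hd : 1 ≤ d + 1} {hL : Odd (ℓ + 1) ∧ 1 < ℓ + 1} {b₀ b₁ : ℝ}
variable {𝔸 : Type} [NormedRing 𝔸] [NormedAlgebra ℂ 𝔸] [CompleteSpace 𝔸]
variable (i : KIdx d ℓ hd hL b₀ b₁)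

/-! ## §1  Coefficient bounds and the letters at a bond -/

omit [NormedAlgebra ℂ 𝔸] [CompleteSpace 𝔸] in
/-- `‖R(u⁻¹)w − R(u′⁻¹)w‖ ≤ 2‖u − u′‖·‖w‖` for bi-contractive `u, u′` — the VARIATION of the inverse transporter (print's `i ad_{(D_μA_ν)}` term of (3.75)).
[cite: Balaban1985BackgroundPropagators, (3.75) p.405, (3.73) p.405] -/
theorem norm_Rinv_sub_Rinv_le {u u' : 𝔸ˣ} (hu : ‖(u : 𝔸)‖ ≤ 1 ∧ ‖((u⁻¹ : 𝔸ˣ) : 𝔸)‖ ≤ 1) (hu' : ‖(u' : 𝔸)‖ ≤ 1 ∧ ‖((u'⁻¹ : 𝔸ˣ) : 𝔸)‖ ≤ 1) (w : 𝔸) :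
    ‖R u⁻¹ w - R u'⁻¹ w‖ ≤ 2 * ‖(u : 𝔸) - u'‖ * ‖w‖ := by
  have h1 := norm_R_sub_R_le (u := u⁻¹) (u' := u'⁻¹) ⟨hu.2, by rw [inv_inv]; exact hu.1⟩ ⟨hu'.2, by rw [inv_inv]; exact hu'.1⟩ w
  have h2 : ‖((u⁻¹ : 𝔸ˣ) : 𝔸) - ((u'⁻¹ : 𝔸ˣ) : 𝔸)‖ ≤ ‖(u : 𝔸) - u'‖ :=
    T4RelativeLadder.norm_inv_sub_inv_le ((T4RelativeLadder.unitaryLike_iff _).2 hu) ((T4RelativeLadder.unitaryLike_iff _).2 hu')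
  calc ‖R u⁻¹ w - R u'⁻¹ w‖ ≤ 2 * ‖((u⁻¹ : 𝔸ˣ) : 𝔸) - ((u'⁻¹ : 𝔸ˣ) : 𝔸)‖ * ‖w‖ := h1
    _ ≤ 2 * ‖(u : 𝔸) - u'‖ * ‖w‖ := by gcongr

section Letters

variable {V : CfgY 𝔸 i} (hU : ∀ μ x, ‖(V μ x : 𝔸)‖ ≤ 1 ∧ ‖(((V μ x)⁻¹ : 𝔸ˣ) : 𝔸)‖ ≤ 1)
include hU

/-- ★ `P1a_ν` at `b = ⟨s, κ⟩`: with `‖V_κ(s) − 1‖ ≤ ω₁` and `‖Y(⟨s+e_κ−e_ν, ν⟩)‖ ≤ t`: `‖(P1a_νY)(b)‖ ≤ |c_f|·2ω₁·t`. [cite: Balaban1985BackgroundPropagators, (3.75) p.405, (3.73) p.405] -/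
theorem norm_P1aY_apply_le (ν : Fin (d + 1)) (s : Site (PV d ℓ i.m i.K hd hL) 0) (κ : Fin (d + 1)) {ω₁ t : ℝ}
    (hW1 : ‖(V κ s : 𝔸) - 1‖ ≤ ω₁) (Y : FBondY i → 𝔸) (hY : ‖Y ⟨(s.shift κ).unshift ν, ν⟩‖ ≤ t) :
    ‖P1aY i V ν Y ⟨s, κ⟩‖ ≤ |i.cf| * (2 * ω₁ * t) := by
  rw [P1aY_apply_mk, norm_smul, Complex.norm_real, Real.norm_eq_abs]
  refine mul_le_mul_of_nonneg_left ?_ (abs_nonneg _)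
  have h := B11Eq135Weitzenbock.norm_R_sub_self_le (hU κ s).2 (Y ⟨(s.shift κ).unshift ν, ν⟩)
  have hω : 0 ≤ ω₁ := (norm_nonneg _).trans hW1
  nlinarith [norm_nonneg ((V κ s : 𝔸) - 1), norm_nonneg (Y ⟨(s.shift κ).unshift ν, ν⟩)]

/-- ★ `P1b_ν` at `b = ⟨s, κ⟩`: with `‖V_μ(s−e_μ) − 1‖ ≤ ω₁` (all `μ`) and `‖Y(⟨s−e_μ, μ⟩)‖ ≤ t`: `‖(P1b_νY)(b)‖ ≤ |c_f|·(d+1)·2ω₁·t`.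
[cite: Balaban1985BackgroundPropagators, (3.75) p.405, (3.73) p.405] -/
theorem norm_P1bY_apply_le (ν : Fin (d + 1)) (s : Site (PV d ℓ i.m i.K hd hL) 0) (κ : Fin (d + 1)) {ω₁ t : ℝ} (ht : 0 ≤ t) (hω₁ : 0 ≤ ω₁)
    (hW1 : ∀ μ : Fin (d + 1), ‖(V μ (s.unshift μ) : 𝔸) - 1‖ ≤ ω₁) (Y : FBondY i → 𝔸) (hY : ∀ μ : Fin (d + 1), ‖Y ⟨s.unshift μ, μ⟩‖ ≤ t) :
    ‖P1bY i V ν Y ⟨s, κ⟩‖ ≤ |i.cf| * (((d : ℝ) + 1) * (2 * ω₁ * t)) := by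
  rw [P1bY_apply_mk]
  split_ifs with h
  · rw [norm_neg, norm_smul, Complex.norm_real, Real.norm_eq_abs]
    refine mul_le_mul_of_nonneg_left ?_ (abs_nonneg _)
    calc ‖∑ μ : Fin (d + 1), _‖ ≤ ∑ μ : Fin (d + 1), (2 * ω₁ * t) := norm_sum_le_of_le _ fun μ _ => ?_
      _ = ((d : ℝ) + 1) * (2 * ω₁ * t) := by rw [Finset.sum_const, Finset.card_univ, Fintype.card_fin, nsmul_eq_mul]; push_cast; ring
    have h1 := norm_Rinv_sub_self_le (hU μ (s.unshift μ)) (Y ⟨s.unshift μ, μ⟩)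
    have w1 := hW1 μ
    have y1 := hY μ
    nlinarith [norm_nonneg ((V μ (s.unshift μ) : 𝔸) - 1), norm_nonneg (Y ⟨s.unshift μ, μ⟩)]
  · rw [norm_zero]; positivity

/-- ★ `P0a` at `b = ⟨s, κ⟩`: with the variation window `‖V_μ(y) − V_μ(y − e_κ)‖ ≤ ω₂` at `y = s + e_κ − e_μ` (all `μ`) and `‖X(⟨s+e_κ−e_μ, μ⟩)‖ ≤ t`:
`‖(P0aX)(b)‖ ≤ c_f²·(d+1)·2ω₂·t`. [cite: Balaban1985BackgroundPropagators, (3.75) p.405, (3.73) p.405 (the `|∇A||A′|` term)] -/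
theorem norm_P0aY_apply_le (s : Site (PV d ℓ i.m i.K hd hL) 0) (κ : Fin (d + 1)) {ω₂ t : ℝ} (hω₂ : 0 ≤ ω₂)
    (hW2 : ∀ μ : Fin (d + 1), ‖(V μ ((s.shift κ).unshift μ) : 𝔸) - V μ (s.unshift μ)‖ ≤ ω₂)
    (X : FBondY i → 𝔸) (hX : ∀ μ : Fin (d + 1), ‖X ⟨(s.shift κ).unshift μ, μ⟩‖ ≤ t) :
    ‖P0aY i V X ⟨s, κ⟩‖ ≤ i.cf ^ 2 * (((d : ℝ) + 1) * (2 * ω₂ * t)) := by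
  rw [P0aY_apply_mk, norm_neg, norm_smul, ← Complex.ofReal_mul, Complex.norm_real, Real.norm_eq_abs, ← sq, abs_of_nonneg (sq_nonneg _)]
  refine mul_le_mul_of_nonneg_left ?_ (sq_nonneg _)
  calc ‖∑ μ : Fin (d + 1), _‖ ≤ ∑ μ : Fin (d + 1), (2 * ω₂ * t) := norm_sum_le_of_le _ fun μ _ => ?_
    _ = ((d : ℝ) + 1) * (2 * ω₂ * t) := by rw [Finset.sum_const, Finset.card_univ, Fintype.card_fin, nsmul_eq_mul]; push_cast; ring
  have h1 := norm_Rinv_sub_Rinv_le (hU μ ((s.shift κ).unshift μ)) (hU μ (s.unshift μ)) (X ⟨(s.shift κ).unshift μ, μ⟩)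
  have w1 := hW2 μ
  have x1 := hX μ
  nlinarith [norm_nonneg ((V μ ((s.shift κ).unshift μ) : 𝔸) - V μ (s.unshift μ)), norm_nonneg (X ⟨(s.shift κ).unshift μ, μ⟩)]

/-- `E*` at a site `w`: with `‖V_μ(w − e_μ) − 1‖ ≤ ω₁` (all `μ`) and `‖X(⟨w−e_μ, μ⟩)‖ ≤ t`: `‖(E*X)(w)‖ ≤ |c_f|·(d+1)·2ω₁·t`.
[cite: Balaban1985BackgroundPropagators, (3.74) p.405] -/
theorem norm_EdY_apply_le (w : Site (PV d ℓ i.m i.K hd hL) 0) {ω₁ t : ℝ}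
    (hW1 : ∀ μ : Fin (d + 1), ‖(V μ (w.unshift μ) : 𝔸) - 1‖ ≤ ω₁) (X : FBondY i → 𝔸) (hX : ∀ μ : Fin (d + 1), ‖X ⟨w.unshift μ, μ⟩‖ ≤ t) :
    ‖EdY i V X (chartY i w)‖ ≤ |i.cf| * (((d : ℝ) + 1) * (2 * ω₁ * t)) := by
  rw [EdY_apply_chartY, norm_smul, Complex.norm_real, Real.norm_eq_abs]
  refine mul_le_mul_of_nonneg_left ?_ (abs_nonneg _)
  calc ‖∑ μ : Fin (d + 1), _‖ ≤ ∑ μ : Fin (d + 1), (2 * ω₁ * t) := norm_sum_le_of_le _ fun μ _ => ?_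
    _ = ((d : ℝ) + 1) * (2 * ω₁ * t) := by rw [Finset.sum_const, Finset.card_univ, Fintype.card_fin, nsmul_eq_mul]; push_cast; ring
  have h1 := norm_Rinv_sub_self_le (hU μ (w.unshift μ)) (X ⟨w.unshift μ, μ⟩)
  have w1 := hW1 μ
  have x1 := hX μ
  nlinarith [norm_nonneg ((V μ (w.unshift μ) : 𝔸) - 1), norm_nonneg (X ⟨w.unshift μ, μ⟩)]

/-- `E∘E*` at `b = ⟨s, κ⟩` (product of two small factors): `‖(E(E*X))(b)‖ ≤ c_f²·(d+1)·4ω₁²·t`. [cite: Balaban1985BackgroundPropagators, (3.75) p.405, (3.73) p.405 (the `|A|²|A′|` term)] -/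
theorem norm_EgY_EdY_apply_le (s : Site (PV d ℓ i.m i.K hd hL) 0) (κ : Fin (d + 1)) {ω₁ t : ℝ} (hω₁ : 0 ≤ ω₁)
    (hW1s : ‖(V κ s : 𝔸) - 1‖ ≤ ω₁) (hW1 : ∀ μ : Fin (d + 1), ‖(V μ ((s.shift κ).unshift μ) : 𝔸) - 1‖ ≤ ω₁)
    (X : FBondY i → 𝔸) (hX : ∀ μ : Fin (d + 1), ‖X ⟨(s.shift κ).unshift μ, μ⟩‖ ≤ t) :
    ‖EgY i V (EdY i V X) ⟨s, κ⟩‖ ≤ i.cf ^ 2 * (((d : ℝ) + 1) * (4 * (ω₁ * ω₁) * t)) := by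
  rw [EgY_apply_mk, norm_smul, Complex.norm_real, Real.norm_eq_abs]
  have hZ := norm_EdY_apply_le i hU (s.shift κ) hW1 X hX
  have h1 := B11Eq135Weitzenbock.norm_R_sub_self_le (hU κ s).2 (EdY i V X (chartY i (s.shift κ)))
  have hc : 0 ≤ |i.cf| := abs_nonneg _
  calc |i.cf| * ‖R (V κ s) (EdY i V X (chartY i (s.shift κ))) - EdY i V X (chartY i (s.shift κ))‖
      ≤ |i.cf| * (2 * ω₁ * (|i.cf| * (((d : ℝ) + 1) * (2 * ω₁ * t)))) := by
        refine mul_le_mul_of_nonneg_left (h1.trans ?_) hc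
        exact mul_le_mul (mul_le_mul_of_nonneg_left hW1s (by norm_num)) hZ (norm_nonneg _) (by positivity)
    _ = i.cf ^ 2 * (((d : ℝ) + 1) * (4 * (ω₁ * ω₁) * t)) := by rw [← sq_abs]; ring

end Letters

/-! ## §2  ★ The (3.73)-bounds of `P¹_ν`, `P⁰` at a bond, from the windows in the distance-2 block neighbourhood -/

section Assembly

variable (q : ↥(cubes (toKT i).D.toDomains))

/-- the stencil sites are within block-graph distance `2` of the output bond's block. [cite: Balaban1984PropagatorsII, (2.46) p.231, bookkeeping] -/
theorem dSite_stencil_le (s : Site (PV d ℓ i.m i.K hd hL) 0) (κ μ : Fin (d + 1)) :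
    dSite i q (blkCubeY i q (chartY i s)) s ≤ 2 ∧ dSite i q (blkCubeY i q (chartY i s)) (s.unshift μ) ≤ 2 ∧
      dSite i q (blkCubeY i q (chartY i s)) (s.shift κ) ≤ 2 ∧ dSite i q (blkCubeY i q (chartY i s)) ((s.shift κ).unshift μ) ≤ 2 := by
  have h0 := dSite_self i q s
  have h1 := (dSite_shift_le i q (blkCubeY i q (chartY i s)) s μ).2
  have h2 := (dSite_shift_le i q (blkCubeY i q (chartY i s)) s κ).1
  have h3 := (dSite_shift_le i q (blkCubeY i q (chartY i s)) (s.shift κ) μ).2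
  refine ⟨by linarith, by linarith, by linarith, by linarith⟩

variable {V : CfgY 𝔸 i} (hU : ∀ μ x, ‖(V μ x : 𝔸)‖ ≤ 1 ∧ ‖(((V μ x)⁻¹ : 𝔸ˣ) : 𝔸)‖ ≤ 1)
include hU

/-- ★ **THE FIRST-ORDER WORDS `P¹_ν` at a bond `b`** («O(1)|A|·|∇_UA′|»): with `‖V − 1‖ ≤ ω₁` on every site whose block is within graph distance `2` of the block of `b`, and
`‖Y‖ ≤ s` on the stencil: `‖(P¹_νY)(b)‖ ≤ |c_f|·2(d+2)ω₁·s`. [cite: Balaban1985BackgroundPropagators, (3.73) p.405, (3.75) p.405] -/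
theorem norm_P1Y_apply_le (ν : Fin (d + 1)) (b : FBondY i) {ω₁ s : ℝ} (hs : 0 ≤ s) (hω₁ : 0 ≤ ω₁)
    (hW1 : ∀ (a : Fin (d + 1)) (y : Site (PV d ℓ i.m i.K hd hL) 0), dSite i q (blkCubeY i q (chartY i b.src)) y ≤ 2 → ‖(V a y : 𝔸) - 1‖ ≤ ω₁)
    (Y : FBondY i → 𝔸) (hY : ∀ e : FBondY i, dSite i q (blkCubeY i q (chartY i b.src)) e.src ≤ 2 → ‖Y e‖ ≤ s) :
    ‖P1Y i V ν Y b‖ ≤ |i.cf| * ((2 + 2 * ((d : ℝ) + 1)) * ω₁ * s) := by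
  obtain ⟨x, κ⟩ := b
  have hst := fun μ => dSite_stencil_le i q x κ μ
  rw [P1Y, LinearMap.add_apply, Pi.add_apply]
  refine (norm_add_le _ _).trans ?_
  have t1 := norm_P1aY_apply_le i hU ν x κ (hW1 κ x (hst κ).1) Y (hY ⟨(x.shift κ).unshift ν, ν⟩ (hst ν).2.2.2)
  have t2 := norm_P1bY_apply_le i hU ν x κ hs hω₁ (fun μ => hW1 μ _ (hst μ).2.1) Y (fun μ => hY ⟨x.unshift μ, μ⟩ (hst μ).2.1)
  have e : |i.cf| * ((2 + 2 * ((d : ℝ) + 1)) * ω₁ * s) = |i.cf| * (2 * ω₁ * s) + |i.cf| * (((d : ℝ) + 1) * (2 * ω₁ * s)) := by ring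
  rw [e]
  exact add_le_add t1 t2

/-- ★ **THE ZEROTH-ORDER PART `P⁰` at a bond `b`** («O(1)(|∇A||A′| + |A|²|A′|)»): with the bond window `ω₁`, the variation window `‖V_a(y) − V_a(y−e_μ)‖ ≤ ω₂` on the
distance-2 block neighbourhood, and `‖X‖ ≤ s` on the stencil: `‖(P⁰X)(b)‖ ≤ c_f²·(d+1)·(2ω₂ + 4ω₁²)·s`. [cite: Balaban1985BackgroundPropagators, (3.73) p.405, (3.75) p.405] -/
theorem norm_P0Y_apply_le (b : FBondY i) {ω₁ ω₂ s : ℝ} (hω₁ : 0 ≤ ω₁) (hω₂ : 0 ≤ ω₂)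
    (hW1 : ∀ (a : Fin (d + 1)) (y : Site (PV d ℓ i.m i.K hd hL) 0), dSite i q (blkCubeY i q (chartY i b.src)) y ≤ 2 → ‖(V a y : 𝔸) - 1‖ ≤ ω₁)
    (hW2 : ∀ (a μ : Fin (d + 1)) (y : Site (PV d ℓ i.m i.K hd hL) 0), dSite i q (blkCubeY i q (chartY i b.src)) y ≤ 2 →
      ‖(V a y : 𝔸) - V a (y.unshift μ)‖ ≤ ω₂)
    (X : FBondY i → 𝔸) (hX : ∀ e : FBondY i, dSite i q (blkCubeY i q (chartY i b.src)) e.src ≤ 2 → ‖X e‖ ≤ s) :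
    ‖P0Y i V X b‖ ≤ i.cf ^ 2 * (((d : ℝ) + 1) * ((2 * ω₂ + 4 * (ω₁ * ω₁)) * s)) := by
  obtain ⟨x, κ⟩ := b
  have hst := fun μ => dSite_stencil_le i q x κ μ
  rw [P0Y, LinearMap.sub_apply, Pi.sub_apply, LinearMap.comp_apply]
  refine (norm_sub_le _ _).trans ?_
  have hW2' : ∀ μ : Fin (d + 1), ‖(V μ ((x.shift κ).unshift μ) : 𝔸) - V μ (x.unshift μ)‖ ≤ ω₂ := fun μ => by
    have h := hW2 μ κ ((x.shift κ).unshift μ) (hst μ).2.2.2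
    rw [← unshift_shift_comm] at h ⊢; rwa [unshift_shift] at h
  have t1 := norm_P0aY_apply_le i hU x κ hω₂ hW2' X (fun μ => hX ⟨(x.shift κ).unshift μ, μ⟩ (hst μ).2.2.2)
  have t2 := norm_EgY_EdY_apply_le i hU x κ hω₁ (hW1 κ x (hst κ).1) (fun μ => hW1 μ _ (hst μ).2.2.2) X
    (fun μ => hX ⟨(x.shift κ).unshift μ, μ⟩ (hst μ).2.2.2)
  have e : i.cf ^ 2 * (((d : ℝ) + 1) * ((2 * ω₂ + 4 * (ω₁ * ω₁)) * s)) =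
      i.cf ^ 2 * (((d : ℝ) + 1) * (2 * ω₂ * s)) + i.cf ^ 2 * (((d : ℝ) + 1) * (4 * (ω₁ * ω₁) * s)) := by ring
  rw [e]
  exact add_le_add t1 t2

end Assembly

/-! ## §3  ★★★ REALIFIED: the (3.73)-majorants of `conj b(P¹_ν)`, `conj b(P⁰)` over r05's cube blocks -/

section Majorant

variable (q : ↥(cubes (toKT i).D.toDomains))

/-- the `(3.73)`-constant of the first-order words of `V₂` (absolute, depending on `d` only, p. 405). [cite: Balaban1985BackgroundPropagators, (3.73) p.405] -/
def cP1 (d : ℕ) : ℝ := 2 * (((d : ℝ) + 1) + 1)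

/-- the `(3.73)`-constant of the zeroth-order part of `V₂` (absolute, depending on `d` only, p. 405). [cite: Balaban1985BackgroundPropagators, (3.73) p.405] -/
def cP0 (d : ℕ) : ℝ := 6 * ((d : ℝ) + 1)

variable {ιb : Type} [Fintype ιb] (b : Module.Basis ιb ℝ 𝔸)
variable {V : CfgY 𝔸 i} (hU : ∀ μ x, ‖(V μ x : 𝔸)‖ ≤ 1 ∧ ‖(((V μ x)⁻¹ : 𝔸ˣ) : 𝔸)‖ ≤ 1)
include hU

/-- ★★★ **THE FIRST-ORDER WORDS OF `V₂`, REALIFIED**: under the bond window `‖V − 1‖ ≤ α₁η∕len(a)` in the distance-2 block neighbourhood,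
`conj b(P¹_ν) ≺ (M₂Σ‖b_j‖)·c_{P1}(d)·e^{2δ}·α₁·len(a)⁻¹·e^{−δd(a,a′)}` over `toB6 (geoCK i □) Rr H` — the `hV1 ν`-shape of `cor35_G_cube_of_pieces`.
[cite: Balaban1985BackgroundPropagators, (3.73) p.405, (3.75) p.405, (3.85) p.407; Balaban1984PropagatorsII, (2.51) p.232] -/
theorem hasMajorant_P1Y {M₂ : ℝ} (hM₂ : 0 ≤ M₂) (hrepr : ∀ (v : 𝔸) (j : ιb), |b.repr v j| ≤ M₂ * ‖v‖) {α₁ : ℝ} (hα₁ : 0 ≤ α₁)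
    (hW1 : ∀ (a : BlkCubeY i q) (a' : Fin (d + 1)) (y : Site (PV d ℓ i.m i.K hd hL) 0), dSite i q a y ≤ 2 →
      ‖(V a' y : 𝔸) - 1‖ ≤ α₁ * ((kGeo i).eta * ((geoCK i q).len a)⁻¹))
    {δ : ℝ} (hδ : 0 ≤ δ) (Rr : ℝ) (H : Prop) (ν : Fin (d + 1)) :
    HasMajorant (g := toB6 (geoCK i q) Rr H) (blkBK i q) (B9Eq352DivFormLetters.conj b ((P1Y i V ν).restrictScalars ℝ))
      (fun a a' => (M₂ * ∑ j, ‖b j‖) * (cP1 d * Real.exp (2 * δ) * α₁ * ((geoCK i q).len a)⁻¹ * Real.exp (-(δ * (geoCK i q).dist a a')))) := by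
  refine B9SectBGpReadingsY.hasMajorant_conj_of_liftY_bound b (g := toB6 (geoCK i q) Rr H) (fun f : FBondY i => blkV1 i.hN (cubeFamY i q) f) _ _
    M₂ hM₂ hrepr fun f E y' B hE hB hoff hbd bb => ?_
  rw [LinearMap.restrictScalars_apply]
  set a := blkV1 i.hN (cubeFamY i q) bb with ha
  have ha' : a = blkCubeY i q (chartY i bb.src) := rfl
  have hη : 0 < (kGeo i).eta := by rw [← geoCK_eta i q]; exact geoCK_eta_pos i q
  have hlen : 0 < (geoCK i q).len a := geoCK_len_pos i q a
  have hηl0 : 0 ≤ (kGeo i).eta * ((geoCK i q).len a)⁻¹ := by positivity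
  set ω₁ := α₁ * ((kGeo i).eta * ((geoCK i q).len a)⁻¹) with hω₁
  have hω₁0 : 0 ≤ ω₁ := mul_nonneg hα₁ hηl0
  have main : ∀ s : ℝ, 0 ≤ s → (∀ e : FBondY i, dSite i q a e.src ≤ 2 → ‖liftY f E e‖ ≤ s) →
      ‖P1Y i V ν (liftY f E) bb‖ ≤ cP1 d * α₁ * ((geoCK i q).len a)⁻¹ * s := by
    intro s hs hX
    have h := norm_P1Y_apply_le i q hU ν bb hs hω₁0 (fun a' y hy => hW1 a a' y (by rw [ha']; exact hy)) (liftY f E)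
      (fun e he => hX e (by rw [ha']; exact he))
    refine h.trans (le_of_eq ?_)
    have hcf : |i.cf| ≠ 0 := by rw [abs_cf_eq]; exact (inv_pos.2 hη).ne'
    rw [abs_cf_eq, hω₁, cP1]
    field_simp
    ring
  by_cases hnear : (geoCK i q).dist a y' ≤ 2
  · have h := main B hB (fun e _ => (Node00.norm_liftY_le f ⟨E, mem_closedBall_zero_iff.2 hE⟩ e).trans (hbd e))
    refine h.trans ?_
    have hexp : 1 ≤ Real.exp (2 * δ) * Real.exp (-(δ * (geoCK i q).dist a y')) := by
      rw [← Real.exp_add]; exact Real.one_le_exp (by nlinarith)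
    have hK0 : 0 ≤ cP1 d * α₁ * ((geoCK i q).len a)⁻¹ := by unfold cP1; positivity
    calc cP1 d * α₁ * ((geoCK i q).len a)⁻¹ * B = cP1 d * α₁ * ((geoCK i q).len a)⁻¹ * 1 * B := by rw [mul_one]
      _ ≤ cP1 d * α₁ * ((geoCK i q).len a)⁻¹ * (Real.exp (2 * δ) * Real.exp (-(δ * (geoCK i q).dist a y'))) * B := by gcongr
      _ = cP1 d * Real.exp (2 * δ) * α₁ * ((geoCK i q).len a)⁻¹ * Real.exp (-(δ * (geoCK i q).dist a y')) * B := by ring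
  · have h := main 0 le_rfl (fun e he => by
      have hne : blkV1 i.hN (cubeFamY i q) e ≠ y' := by
        intro heq
        apply hnear
        have : dSite i q a e.src = (geoCK i q).dist a y' := by rw [← heq]; rfl
        rw [← this]; exact he
      calc ‖liftY f E e‖ ≤ |f e| := Node00.norm_liftY_le f ⟨E, mem_closedBall_zero_iff.2 hE⟩ e
        _ = 0 := by rw [hoff e hne, abs_zero])
    rw [mul_zero] at h
    exact h.trans (mul_nonneg (by unfold cP1; positivity) hB)

/-- ★★★ **THE ZEROTH-ORDER PART OF `V₂`, REALIFIED**: under the bond window, the variation window `‖V_a(y) − V_a(y−e_μ)‖ ≤ α₁(η∕len(a))²` in the distance-2 block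
neighbourhood and `α₁ ≤ 1`, `conj b(P⁰) ≺ (M₂Σ‖b_j‖)·c_{P0}(d)·e^{2δ}·α₁·(len(a)²)⁻¹·e^{−δd(a,a′)}` over `toB6 (geoCK i □) Rr H` — the `hV0`-shape of `cor35_G_cube_of_pieces`.
[cite: Balaban1985BackgroundPropagators, (3.73) p.405, (3.75) p.405, (3.85) p.407; Balaban1984PropagatorsII, (2.51) p.232] -/
theorem hasMajorant_P0Y {M₂ : ℝ} (hM₂ : 0 ≤ M₂) (hrepr : ∀ (v : 𝔸) (j : ιb), |b.repr v j| ≤ M₂ * ‖v‖) {α₁ : ℝ} (hα₁ : 0 ≤ α₁) (hα₁1 : α₁ ≤ 1)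
    (hW1 : ∀ (a : BlkCubeY i q) (a' : Fin (d + 1)) (y : Site (PV d ℓ i.m i.K hd hL) 0), dSite i q a y ≤ 2 →
      ‖(V a' y : 𝔸) - 1‖ ≤ α₁ * ((kGeo i).eta * ((geoCK i q).len a)⁻¹))
    (hW2 : ∀ (a : BlkCubeY i q) (a' μ : Fin (d + 1)) (y : Site (PV d ℓ i.m i.K hd hL) 0), dSite i q a y ≤ 2 →
      ‖(V a' y : 𝔸) - V a' (y.unshift μ)‖ ≤ α₁ * ((kGeo i).eta * ((geoCK i q).len a)⁻¹) ^ 2)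
    {δ : ℝ} (hδ : 0 ≤ δ) (Rr : ℝ) (H : Prop) :
    HasMajorant (g := toB6 (geoCK i q) Rr H) (blkBK i q) (B9Eq352DivFormLetters.conj b ((P0Y i V).restrictScalars ℝ))
      (fun a a' => (M₂ * ∑ j, ‖b j‖) * (cP0 d * Real.exp (2 * δ) * α₁ * ((geoCK i q).len a ^ 2)⁻¹ * Real.exp (-(δ * (geoCK i q).dist a a')))) := by
  refine B9SectBGpReadingsY.hasMajorant_conj_of_liftY_bound b (g := toB6 (geoCK i q) Rr H) (fun f : FBondY i => blkV1 i.hN (cubeFamY i q) f) _ _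
    M₂ hM₂ hrepr fun f E y' B hE hB hoff hbd bb => ?_
  rw [LinearMap.restrictScalars_apply]
  set a := blkV1 i.hN (cubeFamY i q) bb with ha
  have ha' : a = blkCubeY i q (chartY i bb.src) := rfl
  have hη : 0 < (kGeo i).eta := by rw [← geoCK_eta i q]; exact geoCK_eta_pos i q
  have hlen : 0 < (geoCK i q).len a := geoCK_len_pos i q a
  have hηl : (kGeo i).eta * ((geoCK i q).len a)⁻¹ ≤ 1 := by
    rw [← div_eq_mul_inv, div_le_one hlen, ← geoCK_eta i q]; exact B9CubeGeometryInputs.geoCK_eta_le_len i q a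
  have hηl0 : 0 ≤ (kGeo i).eta * ((geoCK i q).len a)⁻¹ := by positivity
  set t := (kGeo i).eta * ((geoCK i q).len a)⁻¹ with ht
  set ω₁ := α₁ * t with hω₁
  set ω₂ := α₁ * t ^ 2 with hω₂
  have hω₁0 : 0 ≤ ω₁ := mul_nonneg hα₁ hηl0
  have hω₂0 : 0 ≤ ω₂ := mul_nonneg hα₁ (sq_nonneg _)
  have main : ∀ s : ℝ, 0 ≤ s → (∀ e : FBondY i, dSite i q a e.src ≤ 2 → ‖liftY f E e‖ ≤ s) →
      ‖P0Y i V (liftY f E) bb‖ ≤ cP0 d * α₁ * ((geoCK i q).len a ^ 2)⁻¹ * s := by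
    intro s hs hX
    have h := norm_P0Y_apply_le i q hU bb hω₁0 hω₂0 (fun a' y hy => hW1 a a' y (by rw [ha']; exact hy))
      (fun a' μ y hy => hW2 a a' μ y (by rw [ha']; exact hy)) (liftY f E) (fun e he => hX e (by rw [ha']; exact he))
    refine h.trans ?_
    have hcf : |i.cf| ≠ 0 := by rw [abs_cf_eq]; exact (inv_pos.2 hη).ne'
    have ecf : i.cf ^ 2 = (((kGeo i).eta)⁻¹) ^ 2 := by rw [← abs_cf_eq, sq_abs]
    rw [ecf]
    have e1 : (((kGeo i).eta)⁻¹) ^ 2 * (((d : ℝ) + 1) * ((2 * ω₂ + 4 * (ω₁ * ω₁)) * s)) =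
        α₁ * ((geoCK i q).len a ^ 2)⁻¹ * (((d : ℝ) + 1) * ((2 + 4 * α₁) * s)) := by
      rw [hω₁, hω₂, ht]; field_simp
    rw [e1, cP0]
    have h2 : 2 + 4 * α₁ ≤ 6 := by linarith
    have h3 : 0 ≤ α₁ * ((geoCK i q).len a ^ 2)⁻¹ := by positivity
    calc α₁ * ((geoCK i q).len a ^ 2)⁻¹ * (((d : ℝ) + 1) * ((2 + 4 * α₁) * s))
        ≤ α₁ * ((geoCK i q).len a ^ 2)⁻¹ * (((d : ℝ) + 1) * (6 * s)) := by gcongr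
      _ = 6 * ((d : ℝ) + 1) * α₁ * ((geoCK i q).len a ^ 2)⁻¹ * s := by ring
  by_cases hnear : (geoCK i q).dist a y' ≤ 2
  · have h := main B hB (fun e _ => (Node00.norm_liftY_le f ⟨E, mem_closedBall_zero_iff.2 hE⟩ e).trans (hbd e))
    refine h.trans ?_
    have hexp : 1 ≤ Real.exp (2 * δ) * Real.exp (-(δ * (geoCK i q).dist a y')) := by
      rw [← Real.exp_add]; exact Real.one_le_exp (by nlinarith)
    have hK0 : 0 ≤ cP0 d * α₁ * ((geoCK i q).len a ^ 2)⁻¹ := by unfold cP0; positivity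
    calc cP0 d * α₁ * ((geoCK i q).len a ^ 2)⁻¹ * B = cP0 d * α₁ * ((geoCK i q).len a ^ 2)⁻¹ * 1 * B := by rw [mul_one]
      _ ≤ cP0 d * α₁ * ((geoCK i q).len a ^ 2)⁻¹ * (Real.exp (2 * δ) * Real.exp (-(δ * (geoCK i q).dist a y'))) * B := by gcongr
      _ = cP0 d * Real.exp (2 * δ) * α₁ * ((geoCK i q).len a ^ 2)⁻¹ * Real.exp (-(δ * (geoCK i q).dist a y')) * B := by ring
  · have h := main 0 le_rfl (fun e he => by
      have hne : blkV1 i.hN (cubeFamY i q) e ≠ y' := by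
        intro heq
        apply hnear
        have : dSite i q a e.src = (geoCK i q).dist a y' := by rw [← heq]; rfl
        rw [← this]; exact he
      calc ‖liftY f E e‖ ≤ |f e| := Node00.norm_liftY_le f ⟨E, mem_closedBall_zero_iff.2 hE⟩ e
        _ = 0 := by rw [hoff e hne, abs_zero])
    rw [mul_zero] at h
    exact h.trans (mul_nonneg (by unfold cP0; positivity) hB)

end Majorant

end Literature.MathematicalPhysics.QuantumFieldTheory.Balaban1983to89.B9Ineq375GradDivBoundsY

end
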